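import Summits.AtomisticToContinuum.Crystallization.Theses.ChessboardParticlePlanes
import Summits.AtomisticToContinuum.Crystallization.Theorems.ChessboardParticlePlanesLjPlaneChessboardKernelEntry
import Summits.AtomisticToContinuum.Crystallization.Theorems.ChessboardParticlePlanesLjPlaneChessboardCrossKernelBound
import Summits.AtomisticToContinuum.Crystallization.Theorems.ChessboardParticlePlanesLjPlaneChessboardMatrixLatticeForm
import Summits.AtomisticToContinuum.Crystallization.Theorems.ChessboardParticlePlanesLjPlaneChessboardModeExpansion
import Mathlib.Analysis.SpecialFunctions.JapaneseBracket

/-!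
# Crux `ChessboardParticlePlanes.LjPlaneChessboard` (stmt-AtomisticToContinuum-6709), line `Sketch`,
# stub `kernelEntry_fourier_bound` — cubic decay of the planar Fourier transform of a kernel entry

The kernel entries `k_{i₀ m}(ρ) = Σ_j T(ρ, j)`, `T = A - B - C - D`, of the per-site chessboard
deficit (`kernelEntry_regular`) are series of translated cross-plane Lennard-Jones kernels
`V_LJ(√(‖ρ - v‖² + b²))` with offsets `|b| ≥ 3/4` growing linearly along the series.  CLAIM (the
summability input of the matrix Poisson positivity `matrixLatticeFormNonneg_finset`):
`‖𝓕[k_{i₀ m}](w)‖ ≤ C (1 + ‖w‖)⁻³.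

PROOF (the M-test of `kernelEntry_regular`, carrying the Fourier side along).  For one kernel the
translate costs a phase (`matrixLatticeForm_fourier_translate`) and the Laplace form
`fourier_ljCrossKernel`, the Laplace-side decay `norm_integral_sliceWeight_mul_exp_le` and Euler's
integral give `‖𝓕[K_ζ](w)‖ ≤ 2π ((2/3)ζ⁻⁴ + (128/15)ζ⁻¹⁰) e^{-πζ‖w‖} ≤ K₁ ζ⁻³ (1 + ‖w‖)⁻³` for
`ζ ≥ 3/4` — the same majorant shape `K |b|⁻³` as the real-space bound `kernelEntry_term_bound`.
The triple "continuous, `|g| ≤ U (1 + ‖ρ‖)⁻³`, `‖𝓕 g‖ ≤ U (1 + ‖w‖)⁻³`" is stable under `±`,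
guards and dominated series `Σ_i g_i`, `Σ U_i < ∞`: such `g_i` are integrable on `ℝ²` (`3 > 2`)
with `Σ_i ∫ |g_i| < ∞`, so `𝓕` and `Σ_i` commute (`integral_tsum_of_summable_integral_norm`) and
`‖Σ_i 𝓕 g_i(w)‖ ≤ (Σ_i U_i)(1 + ‖w‖)⁻³`.  The bookkeeping of `kernelEntry_regular` then gives the
claim.  [folklore]  No definition is introduced.
-/

noncomputable section

namespace Summit.AtomisticToContinuum.Crystallization.Theorems.ChessboardParticlePlanesLjPlaneChessboard

open Literature.MathematicalPhysics.StatisticalMechanics MeasureTheory Set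
open scoped Real InnerProductSpace FourierTransform

/-- A continuous planar function with cubic decay is integrable (as a complex-valued function):
`(1 + ‖ρ‖)⁻³` is integrable on `ℝ²` since `3 > 2` (Mathlib `integrable_one_add_norm`). [folklore] -/
theorem kernelEntryBound_integrable {g : EuclideanSpace ℝ (Fin 2) → ℝ} {U : ℝ} (hg : Continuous g)
    (hle : ∀ ρ, |g ρ| ≤ U * (1 + ‖ρ‖) ^ (-(3 : ℝ))) : Integrable (fun ρ => ((g ρ : ℝ) : ℂ)) := by
  have hI : Integrable (fun ρ : EuclideanSpace ℝ (Fin 2) => (1 + ‖ρ‖) ^ (-(3 : ℝ))) :=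
    integrable_one_add_norm (by rw [finrank_euclideanSpace_fin]; norm_num)
  refine (hI.const_mul U).mono' (Complex.continuous_ofReal.comp hg).aestronglyMeasurable
    (Filter.Eventually.of_forall fun ρ => ?_)
  rw [Complex.norm_real, Real.norm_eq_abs]
  exact hle ρ

/-- The zero function carries the decay triple with any constant `U ≥ 0`. [folklore] -/
theorem kernelEntryBound_zero {U : ℝ} (hU : 0 ≤ U) :
    Continuous (fun _ : EuclideanSpace ℝ (Fin 2) => (0 : ℝ)) ∧
      (∀ ρ : EuclideanSpace ℝ (Fin 2), |(0 : ℝ)| ≤ U * (1 + ‖ρ‖) ^ (-(3 : ℝ))) ∧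
      ∀ w : EuclideanSpace ℝ (Fin 2),
        ‖𝓕 (fun _ : EuclideanSpace ℝ (Fin 2) => ((0 : ℝ) : ℂ)) w‖ ≤ U * (1 + ‖w‖) ^ (-(3 : ℝ)) := by
  refine ⟨continuous_const, fun ρ => by rw [abs_zero]; positivity, fun w => ?_⟩
  rw [Real.fourier_eq]
  simp only [Complex.ofReal_zero, smul_zero, integral_zero, norm_zero]
  positivity

/-- Branching on a constant condition preserves the decay triple. [folklore] -/
theorem kernelEntryBound_ite {P : Prop} [Decidable P] {g₁ g₂ : EuclideanSpace ℝ (Fin 2) → ℝ}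
    {U₁ U₂ : ℝ} (h₁ : P → Continuous g₁ ∧ (∀ ρ, |g₁ ρ| ≤ U₁ * (1 + ‖ρ‖) ^ (-(3 : ℝ))) ∧
      ∀ w, ‖𝓕 (fun ρ => ((g₁ ρ : ℝ) : ℂ)) w‖ ≤ U₁ * (1 + ‖w‖) ^ (-(3 : ℝ)))
    (h₂ : ¬P → Continuous g₂ ∧ (∀ ρ, |g₂ ρ| ≤ U₂ * (1 + ‖ρ‖) ^ (-(3 : ℝ))) ∧
      ∀ w, ‖𝓕 (fun ρ => ((g₂ ρ : ℝ) : ℂ)) w‖ ≤ U₂ * (1 + ‖w‖) ^ (-(3 : ℝ))) :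
    Continuous (fun ρ => if P then g₁ ρ else g₂ ρ) ∧
      (∀ ρ, |(if P then g₁ ρ else g₂ ρ)| ≤ (if P then U₁ else U₂) * (1 + ‖ρ‖) ^ (-(3 : ℝ))) ∧
      ∀ w, ‖𝓕 (fun ρ => (((if P then g₁ ρ else g₂ ρ : ℝ)) : ℂ)) w‖ ≤
        (if P then U₁ else U₂) * (1 + ‖w‖) ^ (-(3 : ℝ)) := by
  by_cases hP : P
  · simp only [if_pos hP]
    exact h₁ hP
  · simp only [if_neg hP]
    exact h₂ hP

/-- Sums and differences preserve the decay triple (constants add); the Fourier side uses the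
integrability of each summand (`kernelEntryBound_integrable`) and linearity of `𝓕`. [folklore] -/
theorem kernelEntryBound_add_sub {g₁ g₂ : EuclideanSpace ℝ (Fin 2) → ℝ} {U₁ U₂ : ℝ}
    (h₁ : Continuous g₁ ∧ (∀ ρ, |g₁ ρ| ≤ U₁ * (1 + ‖ρ‖) ^ (-(3 : ℝ))) ∧
      ∀ w, ‖𝓕 (fun ρ => ((g₁ ρ : ℝ) : ℂ)) w‖ ≤ U₁ * (1 + ‖w‖) ^ (-(3 : ℝ)))
    (h₂ : Continuous g₂ ∧ (∀ ρ, |g₂ ρ| ≤ U₂ * (1 + ‖ρ‖) ^ (-(3 : ℝ))) ∧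
      ∀ w, ‖𝓕 (fun ρ => ((g₂ ρ : ℝ) : ℂ)) w‖ ≤ U₂ * (1 + ‖w‖) ^ (-(3 : ℝ))) :
    (Continuous (fun ρ => g₁ ρ + g₂ ρ) ∧
      (∀ ρ, |g₁ ρ + g₂ ρ| ≤ (U₁ + U₂) * (1 + ‖ρ‖) ^ (-(3 : ℝ))) ∧
      ∀ w, ‖𝓕 (fun ρ => ((g₁ ρ + g₂ ρ : ℝ) : ℂ)) w‖ ≤ (U₁ + U₂) * (1 + ‖w‖) ^ (-(3 : ℝ))) ∧
    (Continuous (fun ρ => g₁ ρ - g₂ ρ) ∧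
      (∀ ρ, |g₁ ρ - g₂ ρ| ≤ (U₁ + U₂) * (1 + ‖ρ‖) ^ (-(3 : ℝ))) ∧
      ∀ w, ‖𝓕 (fun ρ => ((g₁ ρ - g₂ ρ : ℝ) : ℂ)) w‖ ≤ (U₁ + U₂) * (1 + ‖w‖) ^ (-(3 : ℝ))) := by
  obtain ⟨hc₁, hb₁, hF₁⟩ := h₁
  obtain ⟨hc₂, hb₂, hF₂⟩ := h₂
  have i₁ := fun w : EuclideanSpace ℝ (Fin 2) =>
    (Real.fourierIntegral_convergent_iff w).2 (kernelEntryBound_integrable hc₁ hb₁)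
  have i₂ := fun w : EuclideanSpace ℝ (Fin 2) =>
    (Real.fourierIntegral_convergent_iff w).2 (kernelEntryBound_integrable hc₂ hb₂)
  refine ⟨⟨hc₁.add hc₂, fun ρ => ?_, fun w => ?_⟩, ⟨hc₁.sub hc₂, fun ρ => ?_, fun w => ?_⟩⟩
  · rw [add_mul]
    exact (abs_add_le _ _).trans (add_le_add (hb₁ ρ) (hb₂ ρ))
  · have heq : 𝓕 (fun ρ => ((g₁ ρ + g₂ ρ : ℝ) : ℂ)) w =
        𝓕 (fun ρ => ((g₁ ρ : ℝ) : ℂ)) w + 𝓕 (fun ρ => ((g₂ ρ : ℝ) : ℂ)) w := by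
      simp only [Real.fourier_eq]
      rw [← integral_add (i₁ w) (i₂ w)]
      congr 1 with v
      rw [Complex.ofReal_add, smul_add]
    rw [heq, add_mul]
    exact (norm_add_le _ _).trans (add_le_add (hF₁ w) (hF₂ w))
  · rw [add_mul]
    exact (abs_sub _ _).trans (add_le_add (hb₁ ρ) (hb₂ ρ))
  · have heq : 𝓕 (fun ρ => ((g₁ ρ - g₂ ρ : ℝ) : ℂ)) w =
        𝓕 (fun ρ => ((g₁ ρ : ℝ) : ℂ)) w - 𝓕 (fun ρ => ((g₂ ρ : ℝ) : ℂ)) w := by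
      simp only [Real.fourier_eq]
      rw [← integral_sub (i₁ w) (i₂ w)]
      congr 1 with v
      rw [Complex.ofReal_sub, smul_sub]
    rw [heq, add_mul]
    exact (norm_sub_le _ _).trans (add_le_add (hF₁ w) (hF₂ w))

/-- **M-test with the Fourier side.**  If `g i` carry the decay triple with constants `u i`,
`Σ u < ∞`, then so does `ρ ↦ Σ'_i g i ρ` with constant `Σ' u`: the real-space part is
`kernelEntry_mtest`; on the Fourier side the `g i` are integrable with `Σ_i ∫ |g i| < ∞`, so
`𝓕[Σ_i g i] = Σ_i 𝓕[g i]` (`integral_tsum_of_summable_integral_norm`) and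
`‖Σ_i 𝓕[g i](w)‖ ≤ Σ_i u i (1 + ‖w‖)⁻³`. [folklore] -/
theorem kernelEntryBound_tsum {ι : Type*} [Countable ι] {g : ι → EuclideanSpace ℝ (Fin 2) → ℝ}
    {u : ι → ℝ} (h : ∀ i, Continuous (g i) ∧ (∀ ρ, |g i ρ| ≤ u i * (1 + ‖ρ‖) ^ (-(3 : ℝ))) ∧
      ∀ w, ‖𝓕 (fun ρ => ((g i ρ : ℝ) : ℂ)) w‖ ≤ u i * (1 + ‖w‖) ^ (-(3 : ℝ)))
    (hu : Summable u) :
    Continuous (fun ρ => ∑' i, g i ρ) ∧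
      (∀ ρ, |∑' i, g i ρ| ≤ (∑' i, u i) * (1 + ‖ρ‖) ^ (-(3 : ℝ))) ∧
      ∀ w, ‖𝓕 (fun ρ => ((∑' i, g i ρ : ℝ) : ℂ)) w‖ ≤ (∑' i, u i) * (1 + ‖w‖) ^ (-(3 : ℝ)) := by
  have hg : ∀ i, Continuous (g i) := fun i => (h i).1
  have hle : ∀ i ρ, |g i ρ| ≤ u i * (1 + ‖ρ‖) ^ (-(3 : ℝ)) := fun i => (h i).2.1
  obtain ⟨hs, hcont, -⟩ := kernelEntry_mtest hg hu hle
  refine ⟨hcont, fun ρ => ?_, fun w => ?_⟩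
  · calc |∑' i, g i ρ| ≤ ∑' i, |g i ρ| := by
          have h1 := norm_tsum_le_tsum_norm (f := fun i => g i ρ)
            (by simpa only [Real.norm_eq_abs] using hs ρ)
          simpa only [Real.norm_eq_abs] using h1
      _ ≤ ∑' i, u i * (1 + ‖ρ‖) ^ (-(3 : ℝ)) :=
          Summable.tsum_le_tsum (fun i => hle i ρ) (hs ρ) (hu.mul_right _)
      _ = (∑' i, u i) * (1 + ‖ρ‖) ^ (-(3 : ℝ)) := tsum_mul_right
  · -- Fourier side: exchange `𝓕` with the absolutely convergent series
    have hFint : ∀ i, Integrable (fun v : EuclideanSpace ℝ (Fin 2) =>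
        𝐞 (-⟪v, w⟫_ℝ) • ((g i v : ℝ) : ℂ)) := fun i =>
      (Real.fourierIntegral_convergent_iff w).2 (kernelEntryBound_integrable (hg i) (hle i))
    have hI : Integrable (fun ρ : EuclideanSpace ℝ (Fin 2) => (1 + ‖ρ‖) ^ (-(3 : ℝ))) :=
      integrable_one_add_norm (by rw [finrank_euclideanSpace_fin]; norm_num)
    have hFsum : Summable fun i => ∫ v : EuclideanSpace ℝ (Fin 2),
        ‖𝐞 (-⟪v, w⟫_ℝ) • ((g i v : ℝ) : ℂ)‖ := by
      refine Summable.of_nonneg_of_le (fun i => integral_nonneg fun v => norm_nonneg _)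
        (fun i => ?_) (hu.mul_right (∫ v : EuclideanSpace ℝ (Fin 2), (1 + ‖v‖) ^ (-(3 : ℝ))))
      calc ∫ v : EuclideanSpace ℝ (Fin 2), ‖𝐞 (-⟪v, w⟫_ℝ) • ((g i v : ℝ) : ℂ)‖
          ≤ ∫ v : EuclideanSpace ℝ (Fin 2), u i * (1 + ‖v‖) ^ (-(3 : ℝ)) :=
            integral_mono (hFint i).norm (hI.const_mul _) fun v => by
              simpa only [Circle.norm_smul, Complex.norm_real, Real.norm_eq_abs] using hle i v
        _ = u i * ∫ v : EuclideanSpace ℝ (Fin 2), (1 + ‖v‖) ^ (-(3 : ℝ)) :=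
            integral_const_mul _ _
    have heq : 𝓕 (fun ρ => ((∑' i, g i ρ : ℝ) : ℂ)) w = ∑' i, 𝓕 (fun ρ => ((g i ρ : ℝ) : ℂ)) w := by
      simp only [Real.fourier_eq]
      rw [integral_tsum_of_summable_integral_norm hFint hFsum]
      congr 1 with v
      rw [Complex.ofReal_tsum]
      simp_rw [Circle.smul_def, smul_eq_mul]
      exact tsum_mul_left.symm
    have hsw : Summable fun i => ‖𝓕 (fun ρ => ((g i ρ : ℝ) : ℂ)) w‖ :=
      Summable.of_nonneg_of_le (fun i => norm_nonneg _) (fun i => (h i).2.2 w) (hu.mul_right _)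
    rw [heq]
    calc ‖∑' i, 𝓕 (fun ρ => ((g i ρ : ℝ) : ℂ)) w‖ ≤ ∑' i, ‖𝓕 (fun ρ => ((g i ρ : ℝ) : ℂ)) w‖ :=
          norm_tsum_le_tsum_norm hsw
      _ ≤ ∑' i, u i * (1 + ‖w‖) ^ (-(3 : ℝ)) :=
          Summable.tsum_le_tsum (fun i => (h i).2.2 w) hsw (hu.mul_right _)
      _ = (∑' i, u i) * (1 + ‖w‖) ^ (-(3 : ℝ)) := tsum_mul_right

/-- **The decay triple of one kernel term, uniformly in the offset.**  There is `K = K(M) ≥ 0`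
such that for `|b| ≥ 3/4`, `‖v‖ ≤ M|b|` the term `ρ ↦ V_LJ(√(‖ρ - v‖² + b²))` is continuous with
`|·| ≤ K |b|⁻³ (1 + ‖ρ‖)⁻³` (`kernelEntry_term_bound`) and `‖𝓕[·](w)‖ ≤ K |b|⁻³ (1 + ‖w‖)⁻³`: the
translate costs a phase (`matrixLatticeForm_fourier_translate`), the Laplace form
`fourier_ljCrossKernel` with `norm_integral_sliceWeight_mul_exp_le` and Euler's integral gives
`‖𝓕[K_ζ](w)‖ ≤ 2π ((2/3)ζ⁻⁴ + (128/15)ζ⁻¹⁰) e^{-πζ‖w‖}`, `ζ = |b|`, and `ζ⁻⁴ ≤ (4/3)ζ⁻³`,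
`ζ⁻¹⁰ ≤ (4/3)⁷ζ⁻³`, `e^{-πζ‖w‖} ≤ e^{-(3π/4)‖w‖} ≤ (6e^{3π/4}/(3π/4)³)(1 + ‖w‖)⁻³`. [folklore] -/
theorem kernelEntryBound_term {M : ℝ} (hM : 0 ≤ M) :
    ∃ K : ℝ, 0 ≤ K ∧ ∀ (v : EuclideanSpace ℝ (Fin 2)) (b : ℝ), 3 / 4 ≤ |b| → ‖v‖ ≤ M * |b| →
      Continuous (fun ρ : EuclideanSpace ℝ (Fin 2) =>
          lennardJones (Real.sqrt (‖ρ - v‖ ^ 2 + b ^ 2))) ∧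
      (∀ ρ : EuclideanSpace ℝ (Fin 2), |lennardJones (Real.sqrt (‖ρ - v‖ ^ 2 + b ^ 2))| ≤
        K * |b|⁻¹ ^ 3 * (1 + ‖ρ‖) ^ (-(3 : ℝ))) ∧
      ∀ w : EuclideanSpace ℝ (Fin 2), ‖𝓕 (fun ρ : EuclideanSpace ℝ (Fin 2) =>
          ((lennardJones (Real.sqrt (‖ρ - v‖ ^ 2 + b ^ 2)) : ℝ) : ℂ)) w‖ ≤
        K * |b|⁻¹ ^ 3 * (1 + ‖w‖) ^ (-(3 : ℝ)) := by
  obtain ⟨K₀, hK₀, h₀⟩ := kernelEntry_term_bound hM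
  set K₁ : ℝ := 2 * π * (2 / 3 * (4 / 3) + 128 / 15 * (4 / 3) ^ 7) *
    (6 * Real.exp (3 * π / 4) / (3 * π / 4) ^ 3) with hK₁
  have hK₁0 : 0 ≤ K₁ := by positivity
  refine ⟨K₀ + K₁, by positivity, fun v b hb hv => ⟨?_, fun ρ => ?_, fun w => ?_⟩⟩
  · exact kernelEntry_term_continuous v (abs_pos.1 ((hb.trans_lt' (by norm_num))))
  · have h2 : 0 ≤ K₁ * |b|⁻¹ ^ 3 * (1 + ‖ρ‖) ^ (-(3 : ℝ)) := by positivity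
    rw [add_mul, add_mul]
    linarith [h₀ v b ρ hb hv]
  suffices hF1 : ‖𝓕 (fun ρ : EuclideanSpace ℝ (Fin 2) =>
      ((lennardJones (Real.sqrt (‖ρ - v‖ ^ 2 + b ^ 2)) : ℝ) : ℂ)) w‖ ≤
        K₁ * |b|⁻¹ ^ 3 * (1 + ‖w‖) ^ (-(3 : ℝ)) by
    have h2 : 0 ≤ K₀ * |b|⁻¹ ^ 3 * (1 + ‖w‖) ^ (-(3 : ℝ)) := by positivity
    rw [add_mul, add_mul]
    linarith
  have hζ : 0 < |b| := by linarith
  have hζ2 : 0 < |b| / 2 := by positivity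
  -- reduce to the centred kernel with offset `ζ = |b|`
  have hfun : (fun ρ : EuclideanSpace ℝ (Fin 2) =>
      ((lennardJones (Real.sqrt (‖ρ - v‖ ^ 2 + b ^ 2)) : ℝ) : ℂ)) =
      fun ρ => ((lennardJones (Real.sqrt (‖-v + ρ‖ ^ 2 + |b| ^ 2)) : ℝ) : ℂ) := by
    funext ρ
    rw [neg_add_eq_sub, sq_abs]
  rw [hfun, matrixLatticeForm_fourier_translate (fun x : EuclideanSpace ℝ (Fin 2) =>
    ((lennardJones (Real.sqrt (‖x‖ ^ 2 + |b| ^ 2)) : ℝ) : ℂ)) (-v) w, Circle.norm_smul]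
  obtain ⟨-, hF⟩ :=
    fourier_ljCrossKernel (EuclideanSpace ℝ (Fin 2)) finrank_euclideanSpace_fin |b| w hζ
  rw [hF, Complex.norm_real, norm_mul, norm_neg,
    Real.norm_of_nonneg (by positivity : (0 : ℝ) ≤ 2 * π)]
  have key := norm_integral_sliceWeight_mul_exp_le (by positivity : (0 : ℝ) ≤ 2 * π * ‖w‖) hζ
  -- Euler's integral: `∫₀^∞ (l³/144 + l⁹/43545600) e^{-lζ/2} dl = (2/3) ζ⁻⁴ + (128/15) ζ⁻¹⁰`
  have hI : ∫ l in Ioi (0 : ℝ), (l ^ 3 / 144 + l ^ 9 / 43545600) * Real.exp (-(l * (|b| / 2))) =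
      2 / 3 * |b|⁻¹ ^ 4 + 128 / 15 * |b|⁻¹ ^ 10 := by
    simp_rw [add_mul, div_mul_eq_mul_div]
    rw [integral_add ((integrableOn_pow_mul_exp_neg_mul_Ioi 3 hζ2).div_const _)
      ((integrableOn_pow_mul_exp_neg_mul_Ioi 9 hζ2).div_const _), integral_div, integral_div,
      integral_pow_mul_exp_neg_mul_Ioi 3 hζ2, integral_pow_mul_exp_neg_mul_Ioi 9 hζ2]
    simp only [Nat.factorial, Nat.succ_eq_add_one]
    push_cast
    field_simp
    ring
  -- uniformity in `ζ ≥ 3/4`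
  have ht0 : 0 ≤ |b|⁻¹ := inv_nonneg.2 hζ.le
  have ht : |b|⁻¹ ≤ 4 / 3 := (inv_anti₀ (by norm_num) hb).trans_eq (by norm_num)
  have hI' : 2 / 3 * |b|⁻¹ ^ 4 + 128 / 15 * |b|⁻¹ ^ 10 ≤
      (2 / 3 * (4 / 3) + 128 / 15 * (4 / 3) ^ 7) * |b|⁻¹ ^ 3 := by
    nlinarith [mul_le_mul_of_nonneg_right ht (pow_nonneg ht0 3),
      mul_le_mul_of_nonneg_right (pow_le_pow_left₀ ht0 ht 7) (pow_nonneg ht0 3)]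
  -- the exponential: `e^{-π|b|‖w‖} ≤ e^{-(3π/4)‖w‖} ≤ c (1 + ‖w‖)⁻³`
  have hexp : Real.exp (-(2 * π * ‖w‖ * |b| / 2)) ≤
      6 * Real.exp (3 * π / 4) / (3 * π / 4) ^ 3 * (1 + ‖w‖) ^ (-(3 : ℝ)) := by
    refine (Real.exp_le_exp.2 ?_).trans
      (exp_neg_mul_le_rpow_neg_three (m := 3 * π / 4) (by positivity) (norm_nonneg w))
    nlinarith [mul_nonneg (mul_nonneg Real.pi_pos.le (norm_nonneg w)) (sub_nonneg.2 hb)]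
  rw [hI] at key
  refine (mul_le_mul_of_nonneg_left
    (key.trans (mul_le_mul hI' hexp (Real.exp_pos _).le (by positivity))) (by positivity)).trans_eq
    ?_
  rw [hK₁]
  ring

/-- **Piece `A`** (the cross-plane terms) carries the decay triple with summable constants
`u_j = 2K |z i₀ - z (m + jn)|⁻³` (`≲ |j|⁻³` off `j = 0`; `|z i₀ - z (m + jn)| ≥ (3/4) max(1, |j|)`
off the excluded index by `kernelEntry_gap_abs`, `kernelEntry_index_abs`). [folklore] -/
theorem kernelEntryBound_pieceA (z : ℤ → ℝ) (n : ℕ) (δ : EuclideanSpace ℝ (Fin 2)) (i₀ m : ℕ)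
    (hgap : ∀ i : ℤ, (3 : ℝ) / 4 ≤ z (i + 1) - z i) (hi₀ : i₀ < n) (hm : m < n) :
    ∃ u : ℤ → ℝ, Summable u ∧ ∀ j : ℤ,
      Continuous (fun ρ : EuclideanSpace ℝ (Fin 2) =>
        (if (m : ℤ) + j * n = (i₀ : ℤ) then 0 else
          2 * lennardJones (Real.sqrt (‖ρ - (j : ℝ) • δ‖ ^ 2 +
            (z (i₀ : ℤ) - z ((m : ℤ) + j * n)) ^ 2)))) ∧
      (∀ ρ : EuclideanSpace ℝ (Fin 2),
        |(if (m : ℤ) + j * n = (i₀ : ℤ) then 0 else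
          2 * lennardJones (Real.sqrt (‖ρ - (j : ℝ) • δ‖ ^ 2 +
            (z (i₀ : ℤ) - z ((m : ℤ) + j * n)) ^ 2)))| ≤ u j * (1 + ‖ρ‖) ^ (-(3 : ℝ))) ∧
      ∀ w : EuclideanSpace ℝ (Fin 2), ‖𝓕 (fun ρ : EuclideanSpace ℝ (Fin 2) =>
        (((if (m : ℤ) + j * n = (i₀ : ℤ) then 0 else
          2 * lennardJones (Real.sqrt (‖ρ - (j : ℝ) • δ‖ ^ 2 +
            (z (i₀ : ℤ) - z ((m : ℤ) + j * n)) ^ 2)) : ℝ)) : ℂ)) w‖ ≤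
          u j * (1 + ‖w‖) ^ (-(3 : ℝ)) := by
  obtain ⟨K, hK0, hK⟩ := kernelEntryBound_term (M := 4 / 3 * ‖δ‖) (by positivity)
  have hZ : ∀ j : ℤ, 3 / 4 * |(((i₀ : ℤ) - ((m : ℤ) + j * n) : ℤ) : ℝ)| ≤
      |z i₀ - z ((m : ℤ) + j * n)| := fun j => kernelEntry_gap_abs hgap _ _
  have hoff : ∀ j : ℤ, 3 / 4 * |(j : ℝ)| ≤ |z i₀ - z ((m : ℤ) + j * n)| := fun j => by
    have h2 : |(j : ℝ)| ≤ |(((i₀ : ℤ) - ((m : ℤ) + j * n) : ℤ) : ℝ)| := by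
      exact_mod_cast kernelEntry_index_abs hi₀ hm j
    linarith [hZ j]
  have hoff' : ∀ j : ℤ, (m : ℤ) + j * n ≠ i₀ → 3 / 4 ≤ |z i₀ - z ((m : ℤ) + j * n)| :=
    fun j hj => by
      have h2 : (1 : ℝ) ≤ |(((i₀ : ℤ) - ((m : ℤ) + j * n) : ℤ) : ℝ)| := by
        exact_mod_cast Int.one_le_abs (sub_ne_zero.2 (Ne.symm hj))
      nlinarith [hZ j]
  refine ⟨fun j => 2 * (K * |z i₀ - z ((m : ℤ) + j * n)|⁻¹ ^ 3), ?_, fun j => ?_⟩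
  · -- summability: off `j = 0` the constant is `≤ 2K (4/3)³ |j|⁻³`
    refine Summable.of_norm_bounded_eventually
      (kernelEntry_summable_inv_cube.mul_left (2 * K * (4 / 3) ^ 3)) ?_
    refine Filter.eventually_cofinite.2 ((Set.finite_singleton (0 : ℤ)).subset fun j hj => ?_)
    by_contra hj0
    apply hj
    have hjpos : 0 < |(j : ℝ)| := abs_pos.2 (by exact_mod_cast hj0)
    rw [Real.norm_of_nonneg (by positivity)]
    have h := pow_le_pow_left₀ (inv_nonneg.2 (abs_nonneg _))
      (inv_anti₀ (by positivity) (hoff j)) 3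
    calc 2 * (K * |z i₀ - z ((m : ℤ) + j * n)|⁻¹ ^ 3) ≤ 2 * (K * (3 / 4 * |(j : ℝ)|)⁻¹ ^ 3) :=
          mul_le_mul_of_nonneg_left (mul_le_mul_of_nonneg_left h hK0) (by norm_num)
      _ = 2 * K * (4 / 3) ^ 3 * |(j : ℝ)|⁻¹ ^ 3 := by rw [mul_inv, mul_pow]; norm_num; ring
  · have hA := kernelEntryBound_ite (P := (m : ℤ) + j * n = (i₀ : ℤ))
      (fun _ => kernelEntryBound_zero (U := 2 * (K * |z i₀ - z ((m : ℤ) + j * n)|⁻¹ ^ 3))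
        (by positivity)) fun h => by
      have hv : ‖(j : ℝ) • δ‖ ≤ 4 / 3 * ‖δ‖ * |z i₀ - z ((m : ℤ) + j * n)| := by
        rw [norm_smul, Real.norm_eq_abs]
        nlinarith [hoff j, norm_nonneg δ, abs_nonneg (j : ℝ)]
      have h2 := (kernelEntryBound_add_sub (hK _ _ (hoff' j h) hv) (hK _ _ (hoff' j h) hv)).1
      simp only [← two_mul] at h2
      exact h2
    simp only [ite_self] at hA
    exact hA

/-- **K2b — cubic decay of the Fourier transform of a kernel entry**: for a `3/4`-gapped height
sequence `z`, a planar shift `δ` and `i₀, m < n`, the kernel entry `k_{i₀ m} = Σ_j T(·, j)` of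
`kernelEntry_regular` satisfies `‖𝓕[k_{i₀ m}](w)‖ ≤ C (1 + ‖w‖)⁻³` (`StrictMono z`, `0 < c₀`
and the vertical period are not used).  The corrections `B` (offsets `2|k|c`, `2|k|c'`,
`k ≠ 0`) and `C`, `D` (offsets `|2k+1|c`, `|2k+1|c'`; `c, c' ≥ 3/4` the gaps at `i₀`) carry the
decay triple by the M-test `kernelEntryBound_tsum` in `k` over `kernelEntryBound_term`, piece `A`
by `kernelEntryBound_pieceA`; a second M-test in `j` (corrections supported on one `j` each,
`kernelEntry_ite_summable`) assembles `T = A - B - C - D`. [folklore] -/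
theorem kernelEntry_fourier_bound :
    ∀ (z : ℤ → ℝ) (n : ℕ) (δ : EuclideanSpace ℝ (Fin 2)) (c₀ : ℝ) (i₀ m : ℕ),
      0 < n → StrictMono z → (∀ i : ℤ, (3 : ℝ) / 4 ≤ z (i + 1) - z i) → 0 < c₀ →
      (∀ i : ℤ, z (i + n) = z i + c₀) → i₀ < n → m < n →
      ∃ C : ℝ, ∀ w : EuclideanSpace ℝ (Fin 2),
      ‖𝓕 (fun ρ : EuclideanSpace ℝ (Fin 2) => ((∑' j : ℤ,
        ((if (m : ℤ) + j * n = (i₀ : ℤ) then 0 else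
            2 * lennardJones (Real.sqrt (‖ρ - (j : ℝ) • δ‖ ^ 2 + (z (i₀ : ℤ) - z ((m : ℤ) + j * n)) ^ 2)))
          - (if (m : ℤ) + j * n = (i₀ : ℤ) then
              ∑' k : {k : ℤ // k ≠ 0},
                (lennardJones (Real.sqrt (‖ρ‖ ^ 2 + (2 * |(k : ℝ)| * (z ((i₀ : ℤ) + 1) - z (i₀ : ℤ))) ^ 2)) +
                 lennardJones (Real.sqrt (‖ρ‖ ^ 2 + (2 * |(k : ℝ)| * (z (i₀ : ℤ) - z ((i₀ : ℤ) - 1))) ^ 2)))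
             else 0)
          - (if (m : ℤ) + j * n = (i₀ : ℤ) + 1 then
              ∑' k : ℤ, lennardJones (Real.sqrt (‖ρ - (j : ℝ) • δ‖ ^ 2
                + (|2 * (k : ℝ) + 1| * (z ((i₀ : ℤ) + 1) - z (i₀ : ℤ))) ^ 2))
             else 0)
          - (if (m : ℤ) + j * n = (i₀ : ℤ) - 1 then
              ∑' k : ℤ, lennardJones (Real.sqrt (‖ρ - (j : ℝ) • δ‖ ^ 2
                + (|2 * (k : ℝ) + 1| * (z (i₀ : ℤ) - z ((i₀ : ℤ) - 1))) ^ 2))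
             else 0)) : ℝ) : ℂ)) w‖ ≤ C * (1 + ‖w‖) ^ (-(3 : ℝ)) := by
  intro z n δ c₀ i₀ m hn _hz hgap _hc₀ _hper hi₀ hm
  have hc : (3 : ℝ) / 4 ≤ z ((i₀ : ℤ) + 1) - z (i₀ : ℤ) := hgap _
  have hc' : (3 : ℝ) / 4 ≤ z (i₀ : ℤ) - z ((i₀ : ℤ) - 1) := by simpa using hgap ((i₀ : ℤ) - 1)
  obtain ⟨uA, hA, hA'⟩ := kernelEntryBound_pieceA z n δ i₀ m hgap hi₀ hm
  -- piece `B`: M-test in `k ≠ 0` over centred kernels with offsets `2|k|c`, `2|k|c'`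
  obtain ⟨K, hK0, hK⟩ := kernelEntryBound_term (M := 0) le_rfl
  have hk1 : ∀ k : {k : ℤ // k ≠ 0}, (1 : ℝ) ≤ |(k : ℝ)| := fun k => by
    exact_mod_cast Int.one_le_abs k.2
  have hb2 : ∀ (k : {k : ℤ // k ≠ 0}) {d : ℝ}, 3 / 4 ≤ d →
      3 / 4 ≤ |2 * |(k : ℝ)| * d| ∧ K * |2 * |(k : ℝ)| * d|⁻¹ ^ 3 ≤ K * |(k : ℝ)|⁻¹ ^ 3 := by
    intro k d hd
    have h : |(k : ℝ)| ≤ |2 * |(k : ℝ)| * d| := by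
      rw [abs_of_nonneg (by positivity : (0 : ℝ) ≤ 2 * |(k : ℝ)| * d)]
      nlinarith [hk1 k]
    exact ⟨by linarith [hk1 k], mul_le_mul_of_nonneg_left (pow_le_pow_left₀
      (inv_nonneg.2 (abs_nonneg _)) (inv_anti₀ (by linarith [hk1 k]) h) 3) hK0⟩
  have hB := kernelEntryBound_tsum (fun k : {k : ℤ // k ≠ 0} => (kernelEntryBound_add_sub
      (hK 0 _ (hb2 k hc).1 (by simp)) (hK 0 _ (hb2 k hc').1 (by simp))).1)
    (Summable.of_nonneg_of_le (fun k => by positivity)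
      (fun k => add_le_add (hb2 k hc).2 (hb2 k hc').2)
      (((kernelEntry_summable_inv_cube.subtype _).mul_left K).add
        ((kernelEntry_summable_inv_cube.subtype _).mul_left K)))
  simp only [sub_zero] at hB
  -- pieces `C`, `D`: M-test in `k` over kernels centred at `jδ` with offsets `|2k+1|c`, `|2k+1|c'`
  choose K' hK'0 hK' using fun j : ℤ =>
    kernelEntryBound_term (M := 4 / 3 * ‖(j : ℝ) • δ‖) (by positivity)
  have hk1' : ∀ k : ℤ, (1 : ℝ) ≤ |2 * (k : ℝ) + 1| := fun k => by
    exact_mod_cast (Int.one_le_abs (by omega) : (1 : ℤ) ≤ |2 * k + 1|)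
  have hb1 : ∀ (k : ℤ) {d : ℝ}, 3 / 4 ≤ d → 3 / 4 * |2 * (k : ℝ) + 1| ≤ |(|2 * (k : ℝ) + 1| * d)| :=
    fun k d hd => by
      rw [abs_of_nonneg (by positivity : (0 : ℝ) ≤ |2 * (k : ℝ) + 1| * d)]
      nlinarith [hk1' k]
  have hB1 : ∀ (k : ℤ) {d : ℝ}, 3 / 4 ≤ d → 3 / 4 ≤ |(|2 * (k : ℝ) + 1| * d)| :=
    fun k d hd => by nlinarith [hk1' k, hb1 k hd]
  have hv1 : ∀ (j k : ℤ) {d : ℝ}, 3 / 4 ≤ d →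
      ‖(j : ℝ) • δ‖ ≤ 4 / 3 * ‖(j : ℝ) • δ‖ * |(|2 * (k : ℝ) + 1| * d)| :=
    fun j k d hd => by nlinarith [norm_nonneg ((j : ℝ) • δ), hB1 k hd]
  have hinj : Function.Injective fun k : ℤ => 2 * k + 1 := fun k k' h => by simp only at h; omega
  have hs1 : ∀ (j : ℤ) {d : ℝ}, 3 / 4 ≤ d →
      Summable fun k : ℤ => K' j * |(|2 * (k : ℝ) + 1| * d)|⁻¹ ^ 3 := fun j d hd => by
    refine Summable.of_nonneg_of_le (fun k => mul_nonneg (hK'0 j) (by positivity)) (fun k => ?_)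
      (((kernelEntry_summable_inv_cube.comp_injective hinj).mul_left ((4 / 3) ^ 3)).mul_left (K' j))
    refine mul_le_mul_of_nonneg_left ((pow_le_pow_left₀ (inv_nonneg.2 (abs_nonneg _))
      (inv_anti₀ (by linarith [hk1' k]) (hb1 k hd)) 3).trans (le_of_eq ?_)) (hK'0 j)
    simp only [Function.comp_apply]
    push_cast
    rw [mul_inv, mul_pow]
    norm_num
  have hC := fun j : ℤ =>
    kernelEntryBound_tsum (fun k : ℤ => hK' j ((j : ℝ) • δ) _ (hB1 k hc) (hv1 j k hc)) (hs1 j hc)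
  have hD := fun j : ℤ =>
    kernelEntryBound_tsum (fun k : ℤ => hK' j ((j : ℝ) • δ) _ (hB1 k hc') (hv1 j k hc')) (hs1 j hc')
  -- assembly: M-test in `j` for `T = A - B - C - D`
  exact ⟨_, (kernelEntryBound_tsum (fun j => (kernelEntryBound_add_sub (kernelEntryBound_add_sub
      (kernelEntryBound_add_sub (hA' j) (kernelEntryBound_ite (P := (m : ℤ) + j * n = (i₀ : ℤ))
        (fun _ => hB) fun _ => kernelEntryBound_zero le_rfl)).2
      (kernelEntryBound_ite (P := (m : ℤ) + j * n = (i₀ : ℤ) + 1) (fun _ => hC j)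
        fun _ => kernelEntryBound_zero le_rfl)).2
      (kernelEntryBound_ite (P := (m : ℤ) + j * n = (i₀ : ℤ) - 1) (fun _ => hD j)
        fun _ => kernelEntryBound_zero le_rfl)).2)
    (((hA.add (kernelEntry_ite_summable hn _ _ _)).add (kernelEntry_ite_summable hn _ _ _)).add
      (kernelEntry_ite_summable hn _ _ _))).2.2⟩

end Summit.AtomisticToContinuum.Crystallization.Theorems.ChessboardParticlePlanesLjPlaneChessboard

end
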